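import Summits.AtomisticToContinuum.HydrodynamicLimit.Theses.JParityClosure

/-!
# Proposed RESTATEMENT of crux `JParityClosure.EvenStressEnskog` (stmt-AtomisticToContinuum-13079)
# in the PRE-SHOCK, DATA-TIED frame — lead c6 (prover-line-stmt-AtomisticToContinuum-13079-c6-0, 2026-08-17)

`EvenStressEnskogPreShock` is the filed decl VERBATIM except for the frame: after `σ < σ₀` it quantifies over a
classical hard-sphere Euler solution `(ρ,u,θ)` on `[0,T)` (`IsHardSphereEulerSolution σ T ρ u θ`), over flow families
whose local-Gibbs fields satisfy the `t = 0` LLN towards it (`TendstoHydroFieldsAt … 0`), and restricts the horizon to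
`0 < τ < T` — LITERALLY the frame of the sibling crux `OddContactSymmetry` after its rev-5 repair, and exactly the
instances the glue `ParityInBand` / closure crux `ParityBandClosure` consume (their conclusion is `∀ t ∈ Ico 0 T`).

`evenStressEnskogPreShock_of_evenStressEnskog` : the filed crux implies the restatement (the new hypotheses are simply
discarded), so every landed theorem ABOUT the filed decl that has it as a CONCLUSION-side hypothesis transfers, and every
landed reduction `X → EvenStressEnskog` (rung 0 `evenStressEnskog_rung0`, `crux ⇐ (L1) ∧ (L2)`
`cruxOfLocalGibbsTested_holds`, `crux ⇔ (U)`) yields `X → EvenStressEnskogPreShock` by composition.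

Why restate (evidence, three independent seats): Disproof.lean §12 + `Negative/TwoStreamTexture.lean`
(`pairFunctionalP_two_stream`, standing disprover, cycle 2: the Enskog side `B_r` reads sub-`r` velocity VARIANCE, so the
filed `∀ τ` form tacitly asserts mesoscale strong compactness of the empirical velocity field after singularity formation —
"any PROOF for τ beyond blow-up would have to establish a K41-type no-energy-pile-up statement for deterministic hard
spheres"; RECOMMENDATION: restrict to `τ < T`), lead c5 `LINES-RULING-c5.md` (recommendation 2), lead c6 `PICKED.md`
(no statement item of any open route of the programme implies the filed form, because every local-equilibrium /
chaos item that pins the contact value is pre-shock or carries a free rate; the filed form is therefore an isolated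
leaf that no line and no merge can reach).
-/

namespace Summit.AtomisticToContinuum.HydrodynamicLimit.Cruxes.EvenStressEnskog.Restate

open scoped BigOperators Topology Classical MeasureTheory ProbabilityTheory InnerProductSpace
open Filter Set Function MeasureTheory
open Summit.AtomisticToContinuum.HydrodynamicLimit.Theses.JParityClosure

/-- Proposed restatement of `EvenStressEnskog` in the pre-shock, data-tied frame (see module docstring). -/
def EvenStressEnskogPreShock : Prop :=
  ∃ η₀ : ℝ, 0 < η₀ ∧ ∀ (a₀ θ₀ : Literature.MathematicalPhysics.KineticTheory.T3 → ℝ) (u₀ : Literature.MathematicalPhysics.KineticTheory.T3 → Literature.MathematicalPhysics.KineticTheory.V3), Continuous a₀ → Continuous θ₀ → Continuous u₀ → (∀ x, 0 < a₀ x) → (∀ x, 0 < θ₀ x) → ∃ σ₀ : ℝ, 0 < σ₀ ∧ ∀ σ : ℝ, 0 < σ → σ < σ₀ → ∀ (T : ℝ) (ρ θ : ℝ → Literature.MathematicalPhysics.KineticTheory.T3 → ℝ) (u : ℝ → Literature.MathematicalPhysics.KineticTheory.T3 → Literature.MathematicalPhysics.KineticTheory.V3), Literature.MathematicalPhysics.KineticTheory.IsHardSphereEulerSolution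 σ T ρ u θ → ∀ Φ : (N : ℕ) → Literature.Analysis.FluidPDE.HardSphereFlow (Literature.Analysis.FluidPDE.Torus.geometry (Fin 3)) (Literature.MathematicalPhysics.KineticTheory.hsDiameter σ N) (N + 1), Literature.MathematicalPhysics.KineticTheory.TendstoHydroFieldsAt (fun N => Literature.MathematicalPhysics.KineticTheory.localGibbsLaw σ a₀ u₀ θ₀ N (Φ N)) Φ ρ u θ 0 → ∀ τ : ℝ, 0 < τ → τ < T → ∀ χ : ℝ × UnitAddTorus (Fin 3) → ℝ, Continuous χ → ∀ g : ℝ → ℝ, Continuous g → (∀ a, η₀ ≤ a → g a = 0) → ∀ η δ : ℝ, 0 < η → 0 < δ → ∃ r₀ : ℝ, 0 < r₀ ∧ ∀ r : ℝ, 0 < r → r < r₀ → ∃ N₀ : ℕ, ∀ N : ℕ, N₀ ≤ N → let ε := Literature.MathematicalPhysics.KineticTheory.hsDiameter σ N; let G := Literature.Analysis.FluidPDE.Torus.geometry (Fin 3); let γ := fun z (s : ℝ) => (Φ N).flow s z; let bx : UnitAddTorus (Fin 3) → UnitAddTorus (Fin 3) → ℝ := fun x y => 3 / (Real.pi * r ^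 3) * max (1 - Literature.Analysis.FluidPDE.Torus.euclidDist x y / r) 0; let ρm := fun z s (x₀ : UnitAddTorus (Fin 3)) => ∫ q, bx q.1 x₀ ∂(Literature.Analysis.FluidPDE.empiricalMeasure (γ z s)); let Θ := fun (Ξ : EuclideanSpace ℝ (Fin 3) × EuclideanSpace ℝ (Fin 3) × EuclideanSpace ℝ (Fin 3) → ℝ) (v w : EuclideanSpace ℝ (Fin 3)) => ∫ ω : Metric.sphere (0 : EuclideanSpace ℝ (Fin 3)) 1, Ξ ((ω : EuclideanSpace ℝ (Fin 3)), v, w) * Literature.MathematicalPhysics.KineticTheory.hardSphereKernel (w, v) ω ∂Literature.MathematicalPhysics.KineticTheory.sphereMeasure; let B := fun Ξ z s (x₀ : UnitAddTorus (Fin 3)) => ∫ p, bx p.1.1 x₀ * bx p.2.1 x₀ * Θ Ξ p.1.2 p.2.2 ∂((Literature.Analysis.FluidPDE.empiricalMeasure (γ z s)).prod (Literature.Analysis.FluidPDE.empiricalMeasure (γ z s))); let pv := fun z s (i j : Fin (N + 1)) => Literature.Analysis.FluidPDE.reflectVel (G.sepVec (γ z s i).1 (γ z s j).1) ((γ z s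 i).2, (γ z s j).2); let Kc := fun (Fn : Literature.Analysis.FluidPDE.Config (N + 1) (Fin 3) Literature.MathematicalPhysics.KineticTheory.T3 → ℝ → Fin (N + 1) → Fin (N + 1) → ℝ) z => ε / (N + 1 : ℝ) * ∑ᶠ (s : ℝ) (_ : s ∈ Literature.Analysis.FluidPDE.collisionTimes G ε (γ z) ∩ Set.Icc 0 τ), ∑ i : Fin (N + 1), ∑ j : Fin (N + 1), (if i ≠ j ∧ ‖G.sepVec (γ z s i).1 (γ z s j).1‖ = ε then Fn z s i j else 0); let Y : ℝ → ℝ := fun a => 3 / (2 * Real.pi) * deriv Literature.MathematicalPhysics.KineticTheory.hsExcessFreeEnergy a; let Dm := fun (Ξ : EuclideanSpace ℝ (Fin 3) × EuclideanSpace ℝ (Fin 3) × EuclideanSpace ℝ (Fin 3) → ℝ) z => Kc (fun z s i j => χ (s, (γ z s i).1) * g (σ ^ 3 * ρm z s (γ z s i).1) * Ξ (ε⁻¹ • G.sepVec (γ z s i).1 (γ z s j).1, (pv z s i j).1, (pv z s i j).2)) z - σ ^ 3 * ∫ s in Set.Icc (0 : ℝ) τ, ∫ x : UnitAddTorus (Fin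 3), χ (s, x) * g (σ ^ 3 * ρm z s x) * Y (σ ^ 3 * ρm z s x) * B Ξ z s x; let ΞP := fun (k l : Fin 3) (q : EuclideanSpace ℝ (Fin 3) × EuclideanSpace ℝ (Fin 3) × EuclideanSpace ℝ (Fin 3)) => max ⟪q.2.2 - q.2.1, q.1⟫_ℝ 0 * (q.1 k * q.1 l); ∀ k l : Fin 3, Literature.MathematicalPhysics.KineticTheory.localGibbsLaw σ a₀ u₀ θ₀ N (Φ N) {z | η < |Dm (ΞP k l) z|} ≤ ENNReal.ofReal δ

/-- The filed crux implies the proposed restatement (the Euler solution, the `t = 0` LLN and `τ < T` are discarded). -/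
theorem evenStressEnskogPreShock_of_evenStressEnskog (h : EvenStressEnskog) : EvenStressEnskogPreShock := by
  obtain ⟨η₀, hη₀, h⟩ := h
  refine ⟨η₀, hη₀, fun a₀ θ₀ u₀ ha hθ hu ha0 hθ0 => ?_⟩
  obtain ⟨σ₀, hσ₀, h⟩ := h a₀ θ₀ u₀ ha hθ hu ha0 hθ0
  refine ⟨σ₀, hσ₀, fun σ hσ hσ' T ρ θ u _hE Φ _hLLN τ hτ _hτT => ?_⟩
  exact h σ hσ hσ' Φ τ hτ

end Summit.AtomisticToContinuum.HydrodynamicLimit.Cruxes.EvenStressEnskog.Restate
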